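import Summits.ResolutionOfSingularities.ResolutionOfSingularities.Theorems.EquisingularLiftEquisingularLiftNatCompleteIntersectionLift
import Mathlib
import HarnessLib

/-!
# [OURS · L1 W4.5(b) · EL♮(3)] T-RATLIFT-ALG, PART 1 — THE RING CORE OF «RatLift»: the kernel of a parametrisation by forms,
# upstairs over the DVR and downstairs over the residue field
# (crux `EquisingularLiftNatThree` = stmt-ResolutionOfSingularities-20148, parent stmt-20038, line `sections`;
# res-L1-w45b-plan-1 PLANNER-MEMO-g10-1 §1 C3a / §2 cut 1 / object O1 «RatLift»)

NOT a statement of any manuscript. Helper file of the chain res-L1-w45b (cell `res-hironaka`, rung L, slot W4.5(b));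
OURS; AI-written, weaker than expert review; def-free, no `sorry`, standard axioms; filed
`--supports stmt-ResolutionOfSingularities-20148 --as helper` (counted 0, registers nothing).

WHERE IT SITS. PLANNER-MEMO-g10-1 proposes the THIRD NAMED LIFTABLE CLASS for lead-2's class-independent closer
`elnat_noseThenPoints_of_liftableCentre` (p525611): `Z ⊂ ℙⁿ_k` the image of a closed immersion `ℙ^r_k → ℙⁿ_k` (r = 1:
smooth RATIONAL curves of any degree, ACM or not) given by forms `f₀,…,fₙ ∈ k[s]_e`; the lift is «lift the parametrising
forms to `O`». Exactly as for the CI rung (`CILift.ciLift`, res-D-pv-027) and the DET rung (`DetLift.detLift`, res-type-097,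
on this seat's Hilbert–Burch ring core), the (LIFT)-form supplier splits into a RING CORE (this file and part 2
`…RatLiftReduction`) and a `Proj`-level capstone (NOT in this file; 051's / lead-2's pen). The ring core, for ANY
entrywise lift `F` of `f` (`CILift.exists_homogeneous_lift`) with all `F i` forms of one degree `e ≥ 1`, and
`𝔓 := ker (aeval F : O[x_σ] → O[x_τ])` (the homogeneous ideal of the lifted centre `C = V₊(𝔓) ⊂ ℙⁿ_O`):

* `isHomogeneous_aeval` / `aeval_mem_homogeneousSubmodule` / `homogeneousComponent_aeval` — substitution of forms of
  degree `e` multiplies degrees by `e` and commutes with taking homogeneous components (`e ≥ 1`);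
* **`isHomogeneous_ker_aeval`** — `𝔓` is a HOMOGENEOUS ideal (`e ≥ 1`; false for `e = 0`);
* `isPrime_ker_aeval` — `𝔓` is PRIME (`O` a domain); `C_mem_ker_aeval_iff` / `comap_C_ker_aeval` — `𝔓 ∩ O = 0`;
* **`mem_ker_aeval_of_C_mul_mem`** — `𝔓` is SATURATED with respect to every non-zero scalar: `C a · G ∈ 𝔓 → G ∈ 𝔓`
  (in particular `ϖ` is a non-zero-divisor on `O[x]/𝔓` — the flatness input of the `isRegular_and_flat_*Nose` pattern,
  cf. `CILift.mem_span_range_of_mul_mem`, `DetLift.mem_minorsIdeal_of_mul_mem`);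
* `isTorsionFree_quotient_ker_aeval` / **`flat_quotient_ker_aeval`** — `O[x]/𝔓` is torsion-free, hence FLAT over a DVR
  (indeed over any Dedekind domain);
* **`exists_fin_isHomogeneous_span_eq`** / `exists_fin_isHomogeneous_span_eq_ker_aeval` — a finitely generated homogeneous
  ideal (in particular `𝔓`, `O` Noetherian, `σ` finite) is `Ideal.span (Set.range G)` for a FINITE FAMILY OF FORMS
  `G : Fin N → O[x]` with named degrees `D` — the `⟨Ideal.span (Set.range Δt), isHomogeneous_span_of_forall_mem …⟩` shape
  that `projIdealSheaf` and `CILift.comap_projIdealSheaf_span` consume;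
* `map_aeval_eq` / **`map_ker_aeval_le`** — reduction: `π (aeval F G) = aeval f (π G)`, hence
  `𝔓.map π ≤ 𝔭 := ker (aeval f)`; `isHomogeneous_of_map_eq` — the reductions `f i` are forms of degree `e`.

Part 2 (`…RatLiftReduction`) proves the converse inclusion DEGREEWISE wherever the downstairs cofinite clause
`k[x_τ]_{e m} ≤ aeval f (k[x_σ]_m)` holds (Nakayama), i.e. the «exact trace» `(𝔓.map π)~ = 𝔭~` at ring level.
Everything is stated for arbitrary index types `σ` (ambient variables) and `τ` (parameters), so the same core serves
rational curves (`τ = Fin 2`), Veronese / rational-normal-scroll type centres (`τ = Fin (r+1)`).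

DOWNSTAIRS HYPOTHESIS SHAPE SERVED (answering res-L1-w45b-plan-1 2026-08-27T11:39:44Z, for lead-2's typing of
`stub_elnat_ratNoseThenPoints`): shape **(B) EXTRINSIC** — the centre is GIVEN BY THE FORMS: data `(e : ℕ) (f : σ → k[x_τ])`
with `∀ i, f i ∈ 𝒜_k e`, `1 ≤ e`; the centre is the zero set `Z = {y | ∀ g ∈ 𝔭, g ∈ 𝔮_y}` of `𝔭 := ker (aeval f)`
(equivalently `{y | ∀ j, G j ∈ 𝔮_y}` for the named generators of part 1 §3), and «`ℙ(τ)_k → Z` is an isomorphism» is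
the COFINITE CLAUSE `∃ m₀, ∀ m ≥ m₀, homogeneousSubmodule τ k (e * m) ≤ (homogeneousSubmodule σ k m).map (aeval f)`
(pure algebra; for `τ = Fin 2` it says: base-point free of degree `e` and a closed immersion). No `Nonempty (Z ≅ ℙ¹_k)`,
no `Pic ℙ¹` is needed on this side; smoothness of `Z` itself is the consumer's (Jacobian-tuple clause as for CI/DET, or
the intrinsic route) — this core does not use it.

References: folklore commutative algebra (kernels of monomial/parametrisation maps; Matsumura, *Commutative Ring Theory*,
Thm. 7.7 ff. for flat = torsion-free over a DVR [Matsumura1987]); cell: PLANNER-MEMO-g10-1 (res-L1-w45b-plan-1, OURS,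
index only), `CILift.*` (res-D-pv-027, p522728), `DetLift.*` (res-type-097).
-/

set_option linter.dupNamespace false -- mandated namespace `Summit.<Summit>.<Problem>` of this single-conjunct summit

namespace Summit.ResolutionOfSingularities.ResolutionOfSingularities.Cruxes.EquisingularLiftNat.Sections

namespace RatLift

open MvPolynomial

universe u v w w'

/-! ## §1 Substituting forms of one degree: degrees and homogeneous components -/

section Substitution

variable {R : Type u} [CommRing R] {σ : Type w} {τ : Type w'}
  (F : σ → MvPolynomial τ R) {e : ℕ} (hF : ∀ i, (F i).IsHomogeneous e)

include hF in
/-- Substituting forms of degree `e` into a form of degree `m` gives a form of degree `e * m`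
(Mathlib's `IsHomogeneous.aeval`, recorded in the shape used below). [folklore] [OURS · L1 W4.5b] -/
theorem isHomogeneous_aeval {G : MvPolynomial σ R} {m : ℕ} (hG : G.IsHomogeneous m) :
    (aeval F G).IsHomogeneous (e * m) :=
  hG.aeval F hF

include hF in
/-- Submodule form of `isHomogeneous_aeval`: `aeval F` maps `R[x_σ]_m` into `R[x_τ]_{e m}`. [folklore] [OURS · L1 W4.5b] -/
theorem aeval_mem_homogeneousSubmodule {G : MvPolynomial σ R} {m : ℕ} (hG : G ∈ homogeneousSubmodule σ R m) :
    aeval F G ∈ homogeneousSubmodule τ R (e * m) :=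
  (mem_homogeneousSubmodule _ _).mpr (isHomogeneous_aeval F hF ((mem_homogeneousSubmodule _ _).mp hG))

include hF in
/-- The image of `R[x_σ]_m` under `aeval F` lies in `R[x_τ]_{e m}`. [folklore] [OURS · L1 W4.5b] -/
theorem map_homogeneousSubmodule_le (m : ℕ) :
    Submodule.map (aeval F).toLinearMap (homogeneousSubmodule σ R m) ≤ homogeneousSubmodule τ R (e * m) := by
  rintro _ ⟨G, hG, rfl⟩
  exact aeval_mem_homogeneousSubmodule F hF hG

include hF in
/-- **Substitution of forms of degree `e ≥ 1` commutes with homogeneous components**: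
`(aeval F G)_{e m} = aeval F (G_m)`. [folklore] [OURS · L1 W4.5b] -/
theorem homogeneousComponent_aeval (he : 0 < e) (G : MvPolynomial σ R) (m : ℕ) :
    homogeneousComponent (e * m) (aeval F G) = aeval F (homogeneousComponent m G) := by
  classical
  conv_lhs => rw [← sum_homogeneousComponent G]
  rw [map_sum, map_sum, Finset.sum_eq_single m]
  · rw [homogeneousComponent_of_mem (isHomogeneous_aeval F hF (homogeneousComponent_isHomogeneous m G)), if_pos rfl]
  · intro i _ him
    rw [homogeneousComponent_of_mem (isHomogeneous_aeval F hF (homogeneousComponent_isHomogeneous i G)), if_neg]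
    intro h
    exact him (Nat.eq_of_mul_eq_mul_left he h).symm
  · intro hm
    have hlt : G.totalDegree < m := by
      rw [Finset.mem_range, not_lt] at hm
      exact hm
    rw [homogeneousComponent_eq_zero _ _ hlt, map_zero, map_zero]

include hF in
/-- Homogeneous components of `aeval F G` in degrees NOT divisible by `e` vanish. [folklore] [OURS · L1 W4.5b] -/
theorem homogeneousComponent_aeval_eq_zero (G : MvPolynomial σ R) {d : ℕ} (hd : ¬ e ∣ d) :
    homogeneousComponent d (aeval F G) = 0 := by
  classical
  conv_lhs => rw [← sum_homogeneousComponent G]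
  rw [map_sum, map_sum]
  refine Finset.sum_eq_zero fun i _ => ?_
  rw [homogeneousComponent_of_mem (isHomogeneous_aeval F hF (homogeneousComponent_isHomogeneous i G)), if_neg]
  rintro rfl
  exact hd (Dvd.intro i rfl)

end Substitution

/-! ## §2 The kernel `𝔓 = ker (aeval F)`: homogeneous, prime, saturated, torsion-free, flat -/

section Kernel

variable {R : Type u} [CommRing R] {σ : Type w} {τ : Type w'}
  (F : σ → MvPolynomial τ R) {e : ℕ} (hF : ∀ i, (F i).IsHomogeneous e)

include hF in
/-- **The kernel of a substitution of forms of one degree `e ≥ 1` is a homogeneous ideal** for Mathlib's grading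
`MvPolynomial.gradedAlgebra` (bound by `letI` in the statement; files that register Mathlib's grading the usual way see
the identical instance term). (For `e = 0` this fails: `x₀ − x₁²` is killed by `x ↦ (1, 1)`.)
[folklore] [OURS · L1 W4.5b] -/
theorem isHomogeneous_ker_aeval (he : 0 < e) :
    letI := MvPolynomial.gradedAlgebra (σ := σ) (R := R)
    (RingHom.ker (aeval (R := R) F)).IsHomogeneous (homogeneousSubmodule σ R) := by
  letI := MvPolynomial.gradedAlgebra (σ := σ) (R := R)
  intro i G hG
  -- the degree-`i` component of Mathlib's graded decomposition of `R[x_σ]` is `homogeneousComponent i`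
  have e1 : ((DirectSum.decompose (homogeneousSubmodule σ R) G) i : MvPolynomial σ R) = homogeneousComponent i G :=
    MvPolynomial.decomposition.decompose'_apply G i
  rw [RingHom.mem_ker] at hG
  rw [e1, RingHom.mem_ker, ← homogeneousComponent_aeval F hF he, hG, map_zero]

/-- The kernel of a substitution into a polynomial ring over a DOMAIN is prime. [folklore] [OURS · L1 W4.5b] -/
theorem isPrime_ker_aeval [IsDomain R] : (RingHom.ker (aeval (R := R) F)).IsPrime :=
  RingHom.ker_isPrime _

/-- `𝔓 ∩ R = 0`: a constant lies in the kernel of a substitution iff it is zero. [folklore] [OURS · L1 W4.5b] -/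
theorem C_mem_ker_aeval_iff (a : R) : C a ∈ RingHom.ker (aeval (R := R) F) ↔ a = 0 := by
  rw [RingHom.mem_ker, aeval_C, algebraMap_eq, C_eq_zero]

/-- `𝔓 ∩ R = 0`, ideal form: `𝔓.comap C = ⊥`. [folklore] [OURS · L1 W4.5b] -/
theorem comap_C_ker_aeval : (RingHom.ker (aeval (R := R) F)).comap (C : R →+* MvPolynomial σ R) = ⊥ := by
  refine le_antisymm (fun a ha => ?_) bot_le
  rw [Ideal.mem_comap, C_mem_ker_aeval_iff] at ha
  exact (Ideal.mem_bot).mpr ha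

/-- **Saturation with respect to non-zero scalars**: over a domain, `C a · G ∈ 𝔓` with `a ≠ 0` forces `G ∈ 𝔓`
(the target `R[x_τ]` is a domain). With `a = ϖ` this is «`ϖ` is a non-zero-divisor on `O[x]/𝔓`», the flatness input
of the nose pattern (cf. `CILift.mem_span_range_of_mul_mem`, `DetLift.mem_minorsIdeal_of_mul_mem`). [folklore]
[OURS · L1 W4.5b] -/
theorem mem_ker_aeval_of_C_mul_mem [IsDomain R] {a : R} (ha : a ≠ 0) {G : MvPolynomial σ R}
    (h : C a * G ∈ RingHom.ker (aeval (R := R) F)) : G ∈ RingHom.ker (aeval (R := R) F) := by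
  rw [RingHom.mem_ker] at h ⊢
  rw [map_mul, aeval_C, algebraMap_eq] at h
  rcases mul_eq_zero.mp h with h0 | h0
  · exact absurd ((C_eq_zero).mp h0) ha
  · exact h0

/-- Powers version: `C (a ^ n) · G ∈ 𝔓 → G ∈ 𝔓` for `a ≠ 0` over a domain. [folklore] [OURS · L1 W4.5b] -/
theorem mem_ker_aeval_of_C_pow_mul_mem [IsDomain R] {a : R} (ha : a ≠ 0) (n : ℕ) {G : MvPolynomial σ R}
    (h : C (a ^ n) * G ∈ RingHom.ker (aeval (R := R) F)) : G ∈ RingHom.ker (aeval (R := R) F) :=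
  mem_ker_aeval_of_C_mul_mem F (pow_ne_zero n ha) h

/-- Regular-element form of the saturation: every non-zero scalar of a domain `R` acts injectively on `R[x_σ]/𝔓`.
[folklore] [OURS · L1 W4.5b] -/
theorem isSMulRegular_quotient_ker_aeval [IsDomain R] {a : R} (ha : a ≠ 0) :
    IsSMulRegular (MvPolynomial σ R ⧸ RingHom.ker (aeval (R := R) F)) a := by
  rw [isSMulRegular_iff_right_eq_zero_of_smul]
  intro m hm
  obtain ⟨G, rfl⟩ := Ideal.Quotient.mk_surjective m
  have hm2 : Ideal.Quotient.mk (RingHom.ker (aeval (R := R) F)) (a • G) = 0 := hm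
  rw [smul_eq_C_mul, Ideal.Quotient.eq_zero_iff_mem] at hm2
  exact Ideal.Quotient.eq_zero_iff_mem.mpr (mem_ker_aeval_of_C_mul_mem F ha hm2)

/-- The class of `C a` (`a ≠ 0`, `R` a domain) is a non-zero-divisor of `R[x_σ]/𝔓`. [folklore] [OURS · L1 W4.5b] -/
theorem mk_C_mem_nonZeroDivisors [IsDomain R] {a : R} (ha : a ≠ 0) :
    Ideal.Quotient.mk (RingHom.ker (aeval (R := R) F)) (C a) ∈ nonZeroDivisors (MvPolynomial σ R ⧸ RingHom.ker (aeval (R := R) F)) := by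
  refine (mem_nonZeroDivisors_iff_right).mpr fun m hm => ?_
  obtain ⟨G, rfl⟩ := Ideal.Quotient.mk_surjective m
  rw [← map_mul, Ideal.Quotient.eq_zero_iff_mem, mul_comm] at hm
  exact Ideal.Quotient.eq_zero_iff_mem.mpr (mem_ker_aeval_of_C_mul_mem F ha hm)

/-- **`R[x_σ]/𝔓` is torsion-free over a domain `R`.** [folklore] [OURS · L1 W4.5b] -/
theorem isTorsionFree_quotient_ker_aeval [IsDomain R] :
    Module.IsTorsionFree R (MvPolynomial σ R ⧸ RingHom.ker (aeval (R := R) F)) :=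
  ⟨fun _ hr => isSMulRegular_quotient_ker_aeval F hr.ne_zero⟩

/-- **`O[x_σ]/𝔓` is flat over a DVR `O`** (torsion-free over a Dedekind domain is flat, Mathlib). This is the
algebraic flatness of the lifted centre `C = V₊(𝔓) → Spec O`. [cite: Matsumura1987, Thm. 7.7] [OURS · L1 W4.5b] -/
theorem flat_quotient_ker_aeval [IsDedekindDomain R] :
    Module.Flat R (MvPolynomial σ R ⧸ RingHom.ker (aeval (R := R) F)) := by
  haveI := isTorsionFree_quotient_ker_aeval F
  infer_instance

end Kernel

/-! ## §3 Finite families of homogeneous generators with named degrees -/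

section Generators

variable {R : Type u} [CommRing R] {σ : Type w}

/-- **A finitely generated homogeneous ideal of `R[x_σ]` is spanned by a FINITE FAMILY OF FORMS with named degrees**
(the homogeneous components of any finite generating set). Output shape = the `Ideal.span (Set.range G)` /
`D : Fin N → ℕ` data of `projIdealSheaf ⟨span (range Δt), isHomogeneous_span_of_forall_mem …⟩`. [folklore]
[OURS · L1 W4.5b] -/
theorem exists_fin_isHomogeneous_span_eq {I : Ideal (MvPolynomial σ R)} (hfg : I.FG)
    (hI : letI := MvPolynomial.gradedAlgebra (σ := σ) (R := R); I.IsHomogeneous (homogeneousSubmodule σ R)) :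
    ∃ (N : ℕ) (G : Fin N → MvPolynomial σ R) (D : Fin N → ℕ),
      (∀ j, (G j).IsHomogeneous (D j)) ∧ (∀ j, G j ∈ I) ∧ Ideal.span (Set.range G) = I := by
  classical
  letI := MvPolynomial.gradedAlgebra (σ := σ) (R := R)
  obtain ⟨S, hS⟩ := hfg
  set B : ℕ := S.sup totalDegree with hB
  let g : (↥S × Fin (B + 1)) → MvPolynomial σ R := fun p => homogeneousComponent (p.2 : ℕ) (p.1 : MvPolynomial σ R)
  let ε := Fintype.equivFin (↥S × Fin (B + 1))
  have hmem : ∀ p : ↥S × Fin (B + 1), g p ∈ I := fun p =>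
    homogeneousComponent_mem_of_mem hI (hS ▸ Ideal.subset_span p.1.2) _
  refine ⟨Fintype.card (↥S × Fin (B + 1)), g ∘ ε.symm, fun j => ((ε.symm j).2 : ℕ), fun j => ?_, fun j => hmem _, ?_⟩
  · exact homogeneousComponent_isHomogeneous _ _
  · refine le_antisymm ?_ ?_
    · rw [Ideal.span_le]
      rintro _ ⟨j, rfl⟩
      exact hmem _
    · rw [← hS, Ideal.span_le]
      intro s hs
      rw [SetLike.mem_coe, ← sum_homogeneousComponent s]
      refine Ideal.sum_mem _ fun i hi => ?_
      have hiB : i < B + 1 :=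
        lt_of_lt_of_le (Finset.mem_range.mp hi) (Nat.succ_le_succ (Finset.le_sup (f := totalDegree) hs))
      refine Ideal.subset_span ⟨ε (⟨s, hs⟩, ⟨i, hiB⟩), ?_⟩
      simp [g]

variable {τ : Type w'} (F : σ → MvPolynomial τ R) {e : ℕ} (hF : ∀ i, (F i).IsHomogeneous e)

include hF in
/-- **Named homogeneous generators of `𝔓 = ker (aeval F)`** (`R` Noetherian, `σ` finite, `e ≥ 1`):
`𝔓 = Ideal.span (Set.range G)` with `G j` a form of degree `D j`, all in `𝔓`. [folklore] [OURS · L1 W4.5b] -/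
theorem exists_fin_isHomogeneous_span_eq_ker_aeval [IsNoetherianRing R] [Finite σ] (he : 0 < e) :
    ∃ (N : ℕ) (G : Fin N → MvPolynomial σ R) (D : Fin N → ℕ),
      (∀ j, (G j).IsHomogeneous (D j)) ∧ (∀ j, G j ∈ RingHom.ker (aeval (R := R) F)) ∧
        Ideal.span (Set.range G) = RingHom.ker (aeval (R := R) F) :=
  exists_fin_isHomogeneous_span_eq (IsNoetherian.noetherian _) (isHomogeneous_ker_aeval F hF he)

end Generators

/-! ## §4 Reduction along `π : O → k`: `π ∘ aeval F = aeval f ∘ π` and `𝔓.map π ≤ 𝔭` -/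

section Reduction

variable {O : Type u} {k : Type v} [CommRing O] [CommRing k] (π : O →+* k) {σ : Type w} {τ : Type w'}
  (F : σ → MvPolynomial τ O) (f : σ → MvPolynomial τ k) (hFf : ∀ i, MvPolynomial.map π (F i) = f i)

include hFf in
/-- Reduction commutes with substitution: `π (aeval F G) = aeval f (π G)` when `π F = f`. [folklore] [OURS · L1 W4.5b] -/
theorem map_aeval_eq (G : MvPolynomial σ O) :
    MvPolynomial.map π (aeval F G) = aeval f (MvPolynomial.map π G) := by
  rw [aeval_eq_bind₁, aeval_eq_bind₁, map_bind₁]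
  simp_rw [hFf]

include hFf in
/-- **`𝔓.map π ≤ 𝔭`**: the reduction of the upstairs kernel lies in the downstairs kernel. [folklore] [OURS · L1 W4.5b] -/
theorem map_ker_aeval_le :
    (RingHom.ker (aeval (R := O) F)).map (MvPolynomial.map π) ≤ RingHom.ker (aeval (R := k) f) := by
  rw [Ideal.map_le_iff_le_comap]
  intro G hG
  rw [Ideal.mem_comap, RingHom.mem_ker, ← map_aeval_eq π F f hFf, RingHom.mem_ker.mp hG, map_zero]

include hFf in
/-- Elementwise form: `G ∈ 𝔓 → π G ∈ 𝔭`. [folklore] [OURS · L1 W4.5b] -/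
theorem map_mem_ker_aeval_of_mem {G : MvPolynomial σ O} (hG : G ∈ RingHom.ker (aeval (R := O) F)) :
    MvPolynomial.map π G ∈ RingHom.ker (aeval (R := k) f) :=
  map_ker_aeval_le π F f hFf (Ideal.mem_map_of_mem _ hG)

include hFf in
/-- The reductions `f i = π (F i)` of forms of degree `e` are forms of degree `e`. [folklore] [OURS · L1 W4.5b] -/
theorem isHomogeneous_of_map_eq {e : ℕ} (hF : ∀ i, (F i).IsHomogeneous e) (i : σ) : (f i).IsHomogeneous e := by
  rw [← hFf i]
  exact (hF i).map π

omit hFf in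
/-- The reduction of the span of a lifted family is the span of the reduced family:
`(span (range G)).map π = span (range (π ∘ G))` (Mathlib's `Ideal.map_span`, in the shape used by
`CILift.comap_projIdealSheaf_span`). [folklore] [OURS · L1 W4.5b] -/
theorem map_span_range_eq {N : ℕ} (G : Fin N → MvPolynomial σ O) :
    (Ideal.span (Set.range G)).map (MvPolynomial.map π) = Ideal.span (Set.range (fun j => MvPolynomial.map π (G j))) := by
  rw [Ideal.map_span, ← Set.range_comp]
  rfl

end Reduction

end RatLift

end Summit.ResolutionOfSingularities.ResolutionOfSingularities.Cruxes.EquisingularLiftNat.Sections
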